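import Mathlib
import Summits.MatrixMultiplication.MatrixMultiplication.Theorems.SnSubsetDichotomyPolynomialSlackHeavyCellFibring

/-!
# Two dense quotient sets: the kept level-one term forces a heavy cell

Crux `Summit.MatrixMultiplication.MatrixMultiplication.Theses.SnSubsetDichotomy.PolynomialSlack`
(item `stmt-MatrixMultiplication-8306`), level-one programme, lead c6 ("beyond one half", line
`transport-split-hull`), the case of TWO dense quotient sets `A = S⁻¹T`, `B = T⁻¹U` and a sparse one
`C = U⁻¹S`. For a TPP triple `S, T, U ⊆ S_n` with quotient profiles `d_A = m_{ST}/|S||T|`,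
`d_B = m_{TU}/|T||U|`, `d_C = m_{US}/|U||S|` (pair marginals `m_{XY}(i,j) = #{(x,y) ∈ X × Y : y j = x i}`),
a heavy threshold `θ_C ≥ 16/n` with heavy part `p_C = (d_C - 1/n)·[θ_C ≤ d_C]` of the centred
`C`-profile, and `δ < 1`, the kept level-one inequality
`1 - δ ≤ -(n-1)·Σ_{i,j,k} (d_A(i,j) - 1/n)·(d_B(j,k) - 1/n)·p_C(k,i)` forces `θ_C²·|S||T||U| ≤ n·B` for
every bound `B` on the volumes of TPP triples of `S_{n-1}` (`volume_le_of_dense_pair`): its right-hand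
side vanishes unless some cell `(k,i)` of `C` is heavy, and a heavy cell `θ_C·|U||S| ≤ m_{US}(k,i)`
gives the bound by the dominant-common-value fibring `volume_le_of_heavy_cell` (file
`…HeavyCellFibring`).
-/

namespace Summit.MatrixMultiplication.MatrixMultiplication.Theorems.PolynomialSlack

open scoped BigOperators
open Literature.Combinatorics.Additive (TripleProductProperty)

-- `Summit.<Summit>.<Problem>` is the tree's mandated summit-side namespace (CONVENTIONS §2); for
-- this single-conjunct summit the two coincide, so each declaration silences `dupNamespace`.
set_option linter.dupNamespace false

/-- **Two dense quotients ⇒ small volume.** For `n ≥ 2`, a TPP triple `S, T, U ⊆ S_n` of non-empty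
sets, a bound `B` on the volumes of TPP triples of `S_{n-1}`, quotient profiles `dA, dB, dC`, a heavy
threshold `θC ≥ 16/n` with heavy part `pC = (dC - 1/n)·[θC ≤ dC]`, `δ < 1`, and the kept level-one
inequality `1 - δ ≤ -(n-1)·Σ_{i,j,k} (dA i j - 1/n)·(dB j k - 1/n)·pC k i`:
`θC²·|S||T||U| ≤ n·B`. Proof: if no cell `(k,i)` had `θC ≤ dC k i` then `pC = 0` and the kept
inequality would read `1 - δ ≤ 0`; so a heavy cell exists, i.e. `θC·|U||S| ≤ m_{US}(k,i)`
(`|U||S| > 0`), and `volume_le_of_heavy_cell` (dominant common value + one-point fibring, with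
`0 ≤ 16/n ≤ θC`) bounds the volume. (The profile identities `hdA`, `hdB` and `hT0` belong to the
common interface of the case analysis; this case does not need them.) [folklore] -/
theorem volume_le_of_dense_pair {n : ℕ} (hn : 2 ≤ n) (B : ℕ)
    (hB : ∀ S' T' U' : Finset (Equiv.Perm (Fin (n - 1))), TripleProductProperty S' T' U' →
      S'.card * T'.card * U'.card ≤ B)
    {S T U : Finset (Equiv.Perm (Fin n))} (hTPP : TripleProductProperty S T U)
    (hS0 : S.Nonempty) (hT0 : T.Nonempty) (hU0 : U.Nonempty)
    (dA dB dC pC : Fin n → Fin n → ℝ)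
    (hdA : ∀ i j, dA i j = (((S ×ˢ T).filter fun st => st.2 j = st.1 i).card : ℝ) / (S.card * T.card : ℕ))
    (hdB : ∀ j k, dB j k = (((T ×ˢ U).filter fun tu => tu.2 k = tu.1 j).card : ℝ) / (T.card * U.card : ℕ))
    (hdC : ∀ k i, dC k i = (((U ×ˢ S).filter fun us => us.2 i = us.1 k).card : ℝ) / (U.card * S.card : ℕ))
    (θC δ : ℝ) (hθC : 16 / (n : ℝ) ≤ θC)
    (hpC : ∀ k i, pC k i = if θC ≤ dC k i then dC k i - 1 / n else 0) (hδ : δ < 1)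
    (hkept : 1 - δ ≤ -((n : ℝ) - 1) *
      ∑ i : Fin n, ∑ j : Fin n, ∑ k : Fin n, (dA i j - 1 / n) * (dB j k - 1 / n) * pC k i) :
    θC ^ 2 * ((S.card * T.card * U.card : ℕ) : ℝ) ≤ n * B := by
  classical
  -- `hT0`, `hdA`, `hdB`: interface hypotheses of the case analysis, not needed in this case
  have _ := And.intro hT0 (And.intro hdA hdB)
  -- scalars
  have hn1 : 1 ≤ n := le_trans (by norm_num) hn
  have hn0 : (0 : ℝ) < n := by exact_mod_cast lt_of_lt_of_le Nat.zero_lt_two hn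
  have hθ0 : 0 ≤ θC := le_trans (div_nonneg (by norm_num) hn0.le) hθC
  -- a heavy cell `(k, i)` exists: otherwise `pC = 0` and the kept inequality reads `1 - δ ≤ 0`
  obtain ⟨k, i, hki⟩ : ∃ k i, θC ≤ dC k i := by
    by_contra hno
    have hp0 : ∀ k i, pC k i = 0 := fun k i => by rw [hpC, if_neg fun h => hno ⟨k, i, h⟩]
    have hsum : ∑ i : Fin n, ∑ j : Fin n, ∑ k : Fin n,
        (dA i j - 1 / n) * (dB j k - 1 / n) * pC k i = 0 :=
      Finset.sum_eq_zero fun i _ => Finset.sum_eq_zero fun j _ => Finset.sum_eq_zero fun k _ => by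
        rw [hp0, mul_zero]
    rw [hsum, mul_zero] at hkept
    linarith
  -- the heavy cell in counting form: `θC·|U||S| ≤ m_{US}(k,i)`
  have hP : (0 : ℝ) < (U.card * S.card : ℕ) := by
    exact_mod_cast Nat.mul_pos hU0.card_pos hS0.card_pos
  have hcell : θC * (U.card * S.card : ℕ) ≤ ((U ×ˢ S).filter fun us => us.2 i = us.1 k).card := by
    rw [hdC] at hki
    exact (le_div_iff₀ hP).1 hki
  exact volume_le_of_heavy_cell hn1 B hB hTPP i k θC hθ0 hcell

end Summit.MatrixMultiplication.MatrixMultiplication.Theorems.PolynomialSlack
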